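import Summits.QuantumFields.YangMills.Theorems.BalabanUVNodesN15KingModelGraphTreeDecayThm35
import Summits.QuantumFields.YangMills.Theorems.BalabanUVNodesN15KingModelGraphPowerCountingSparse

/-!
# BalabanUVNodes ∕ N15 — THE KING-MODEL RUNG (PART Α-p): A HYPOTHESIS-FREE FAMILY — (3.56) WITH ITS RATE AND ITS TREE DECAY, WITH KING's OWN EXTERNAL LINES,
# for EVERY SPARSE CONNECTED GRAPH OF `G`-LINES and for EVERY CONNECTED PSEUDOFOREST OF `G`-LINES in `1 ≤ d ≤ 3` (no tadpole, no parallel pair, at most one loop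
# per component of each sub-line-set): the size (3.38)'s shape, the difference (3.56), and (3.56) summed over field points — NO positivity hypothesis, NO
# certificate, NO abstract one-vertex factor
# (Track A, DAG node N15 = NE2; FAN-OUT v1.1 §N15 s3 «KING-MODEL RUNG … NE2's analogue DECIDED in the model»)

HONEST FRAMING.  Count-neutral (cell `pub-ymgap`, seat `pub-ymgap-dag-n15-e` g29; `--supports stmt-QuantumFields-27366 --as helper` = K3⁸
`SpineGivenEndpointR13SepCoPHV`).  TEMPLATE LITERATURE: C. King, *The U(1) Higgs model. I. The continuum limit*, Commun. Math. Phys. **102** (1986) 649–677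
[King1986], Proposition 3.6 (3.56) p. 662, Theorem 3.5 (3.38) p. 660, p. 664 («every subgraph has positive degree») — KING's OWN `A = 0` MODEL.  Part Δ-d
(`…GraphPowerCountingSparse`) decided p. 664's sentence for sparse graphs of `G`-lines (`((d+1) − 2)|S| < (d+1)(|V(S)| − 1)` for every non-empty connected
sub-line-set) and for connected pseudoforests in `1 ≤ d ≤ 3` (part Δ-c `posSubgraphsBy_pseudoforest`, by counting), with ABSTRACT one-vertex factors and no
tree decay.  THIS FILE feeds those certificates to parts Α-g ∕ Α-l ∕ Α-n: King's external lines (3.71), the rate `L^{−γK}` AND the tree decay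
`exp[−δ·d_tree({y_υ})]`, for the whole class.  NOT Bałaban's `G(U)`; NOT a node discharge; nothing continuum ∕ ℝ⁴ ∕ OS ∕ mass-gap ∕ Clay.  0 `sorry`;
standard axioms.

WHAT THIS FILE PROVES (namespace `Summit.QuantumFields.YangMills.BalabanUVNodes.N15KingModelRung.Curved`).
* §1 `posSubgraphsBy_lineExp_of_sparse`, `posSubgraphsBy_lineExp_pseudoforest` — p. 664's sentence in part Α's spelling `PosSubgraphsBy src tgt 0 (d+1) (lineExp ∘ none)`
  for sparse graphs (any `d`) and for pseudoforests (`1 ≤ d ≤ 3`).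
* §2 ★★★ **`king_prop36_pseudoforest_extLegs_treeDecay`** (`1 ≤ d ≤ 3`) — for odd `L ≥ 3`, `a > 0`, `m₀² ≥ 0` there are `A ≥ 1`, `γ, δ > 0` such that for every
  mass `0 < m² ≤ m₀²`, index `jv`, `n ≥ 1`, EVERY connected pseudoforest of `G`-lines (`src ℓ ≠ tgt ℓ`; `|S| ≤ |V(S)|`; `|S| = 2 ⇒ |V(S)| ≥ 3`) and every family
  of King's external lines: `|E^{(K+n)}(H) − E^{(K)}(H)| ≤ exp[−δ·treeLength |·| {y_υ}]·L^{−γK}·A^{2m+nn+|Υ|}·m!·(m + |Υ| + 1)` — (3.56) with rate and tree decay for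
  an infinite hypothesis-free class; ★★★ `king_prop36_sparse_extLegs_treeDecay` — the same for sparse connected graphs of `G`-lines (any `d`).
* §3 ★★ `king_graph_size_pseudoforest_extLegs_treeDecay` — Thm 3.5 (i) (3.38)'s shape (part Α-l `_subgraphs`) for the class.
* §4 ★★ `king_prop36_pseudoforest_fieldPoints_treeDecay` — (3.56) summed over `r` field-point legs (part Α-n §2) for the class.
* §5 (v1.1) `posDegrees_kingDegList_pseudoforest` ((3.77) verbatim for the class), ★★ `king_thm35_pseudoforest_fieldPoints_treeDecay` — Thm 3.5 (ii) (3.39)'s shape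
  (part Α-n) for the class.

HONEST SCOPE.  `G`-lines only (`κ ≡ none`); graphs with `∂G` lines or denser loops need King's §3.5 renormalisation (NOT typed).  Locators: [King1986] Prop. 3.6
(3.56) p.662, Thm 3.5 (3.38) p.660, (3.57) p.662, p.664, (3.77) p.666.
-/

noncomputable section

namespace Summit.QuantumFields.YangMills.BalabanUVNodes.N15KingModelRung.Curved

open scoped BigOperators
open Finset
open Literature.MathematicalPhysics.QuantumFieldTheory.Balaban1983to89.B4Sect5Proof (latticeConst)
open Literature.MathematicalPhysics.QuantumFieldTheory.Balaban1983to89.B5Prop11Plancherel (Tor fine)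
open Summit.QuantumFields.YangMills.BalabanUVNodes.N15KingModelRung (KingVolIndex kingVol kingVol_neZero basePt)
open Summit.QuantumFields.YangMills.BalabanUVNodes.N15KingModelRung.Graph

variable {d : ℕ} (L : ℕ) [NeZero L]

/-! ## §1 The certificates in part Α's spelling -/

section Certificates
variable {nn m : ℕ} {src tgt : Fin m → Fin (nn + 1)}

omit L [NeZero L] in
/-- p. 664's sentence for SPARSE connected graphs of `G`-lines, spelled with `lineExp`. [cite: King1986, p.664 («every subgraph have positive degree D»)] -/
theorem posSubgraphsBy_lineExp_of_sparse
    (h : ∀ S : Finset (Fin m), S.Nonempty → (∀ u ∈ lineVerts src tgt S, ∀ v ∈ lineVerts src tgt S, LConn src tgt S u v) →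
      (((d + 1 : ℕ) : ℝ) - 2) * (S.card : ℝ) < ((d + 1 : ℕ) : ℝ) * (((lineVerts src tgt S).card : ℝ) - 1)) :
    PosSubgraphsBy src tgt 0 ((d + 1 : ℕ) : ℝ) (fun ℓ => lineExp (d + 1) ((fun _ : Fin m => (none : Option (Fin (d + 1)))) ℓ)) := by
  rw [show (fun ℓ => lineExp (d + 1) ((fun _ : Fin m => (none : Option (Fin (d + 1)))) ℓ)) = fun _ => (2 : ℝ) - ((d + 1 : ℕ) : ℝ)
    from lineExp_GLines_eq m]
  exact posSubgraphsBy_GLines_of_sparse _ h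

omit L [NeZero L] in
/-- p. 664's sentence for connected PSEUDOFORESTS of `G`-lines in `1 ≤ d ≤ 3` (part Δ-c, by counting), spelled with `lineExp`. [cite: King1986, p.664] -/
theorem posSubgraphsBy_lineExp_pseudoforest (hd1 : 1 ≤ d) (hd3 : d ≤ 3) (h1 : ∀ ℓ, src ℓ ≠ tgt ℓ)
    (h2 : ∀ S : Finset (Fin m), S.card ≤ (lineVerts src tgt S).card) (h3 : ∀ S : Finset (Fin m), S.card = 2 → 3 ≤ (lineVerts src tgt S).card) :
    PosSubgraphsBy src tgt 0 ((d + 1 : ℕ) : ℝ) (fun ℓ => lineExp (d + 1) ((fun _ : Fin m => (none : Option (Fin (d + 1)))) ℓ)) := by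
  have hdV : (2 : ℝ) ≤ ((d + 1 : ℕ) : ℝ) := by
    have : (2 : ℕ) ≤ d + 1 := by omega
    exact_mod_cast this
  have hdV' : ((d + 1 : ℕ) : ℝ) ≤ 4 := by
    have : d + 1 ≤ (4 : ℕ) := by omega
    exact_mod_cast this
  rw [show (fun ℓ => lineExp (d + 1) ((fun _ : Fin m => (none : Option (Fin (d + 1)))) ℓ)) = fun _ => (2 : ℝ) - ((d + 1 : ℕ) : ℝ)
    from lineExp_GLines_eq m]
  exact posSubgraphsBy_pseudoforest h1 h2 h3 hdV hdV' (by norm_num)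

end Certificates

/-! ## §2 (3.56) with rate and tree decay for the class -/

section Prop36Class

/-- ★★★ **(3.56) WITH ITS RATE AND ITS TREE DECAY FOR EVERY SPARSE CONNECTED GRAPH OF `G`-LINES WITH KING's EXTERNAL LINES — NO POSITIVITY HYPOTHESIS**:
part Α-g's `king_prop36_extLegs_treeDecay_collected` with p. 664's sentence discharged by sparsity (§1).  For every family `Υ` of King's external lines (`υ₀` at
the vertex `0`): `|E^{(K+n)}(H) − E^{(K)}(H)| ≤ exp[−δ·treeLength |·| {y_υ}]·L^{−γK}·(A^{2m+nn+|Υ|}·(m!·(m + |Υ| + 1)))`.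
[cite: King1986, Prop. 3.6 (3.56) p.662, p.664, Prop. 3.8 (3.71) p.664, (3.77) p.666] -/
theorem king_prop36_sparse_extLegs_treeDecay (hLodd : Odd L) (hL : 2 ≤ L) {a : ℝ} (ha : 0 < a) {m0sq : ℝ} (hm0 : 0 ≤ m0sq) :
    ∃ A γ δ : ℝ, 1 ≤ A ∧ 0 < γ ∧ 0 < δ ∧ ∀ (msq : ℝ), 0 < msq → msq ≤ m0sq → ∀ (jv : KingVolIndex d) (n : ℕ), 1 ≤ n →
      ∀ (nn m : ℕ) (src tgt : Fin m → Fin (nn + 1)), (∀ v, LConn src tgt univ 0 v) →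
      (∀ S : Finset (Fin m), S.Nonempty → (∀ u ∈ lineVerts src tgt S, ∀ v ∈ lineVerts src tgt S, LConn src tgt S u v) →
        (((d + 1 : ℕ) : ℝ) - 2) * (S.card : ℝ) < ((d + 1 : ℕ) : ℝ) * (((lineVerts src tgt S).card : ℝ) - 1)) →
      ∀ (Υ : Type) [Fintype Υ] [DecidableEq Υ] (vtx : Υ → Fin (nn + 1)) (υ₀ : Υ), vtx υ₀ = 0 →
      ∀ (b : Υ → Tor (kingVol L jv)) (κe : Υ → Option (Fin (d + 1))),
        haveI := kingVol_neZero L jv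
        |graphValLS ((((L : ℝ) ^ (jv.K + n))⁻¹) ^ (d + 1)) src tgt (fun _ => kingGLine L (kingVol L jv) a msq (jv.K + n) none) vtx
              (fun υ => kingExtHi L a msq jv n (b υ) (κe υ))
            - graphValLS ((((L : ℝ) ^ jv.K)⁻¹) ^ (d + 1)) src tgt (fun _ => kingGLine L (kingVol L jv) a msq jv.K none) vtx
              (fun υ => kingExtLo L a msq jv (b υ) (κe υ))|
          ≤ Real.exp (-(δ * treeLength (kingDist L jv) (anchors fun υ => some (basePt (L ^ jv.K) (kingVol L jv) (b υ)))))
            * (L : ℝ) ^ (-(γ * jv.K)) * (A ^ (2 * m + nn + Fintype.card Υ) * ((m.factorial : ℝ) * (m + Fintype.card Υ + 1))) := by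
  obtain ⟨A, γ, δ, hA, hγ, hδ, H⟩ := king_prop36_extLegs_treeDecay_collected (d := d) L hLodd hL ha hm0
  refine ⟨A, γ, δ, hA, hγ, hδ, fun msq hm hcap jv n hn nn m src tgt hconn hsparse Υ _ _ vtx υ₀ hυ₀ b κe => ?_⟩
  exact H msq hm hcap jv n hn nn m src tgt hconn (fun _ => none) (posSubgraphsBy_lineExp_of_sparse hsparse) Υ vtx υ₀ hυ₀ b κe

/-- ★★★ **(3.56) WITH ITS RATE AND ITS TREE DECAY FOR EVERY CONNECTED PSEUDOFOREST OF `G`-LINES WITH KING's EXTERNAL LINES, `1 ≤ d ≤ 3` — NO HYPOTHESIS ON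
DEGREES**: no tadpole (`src ℓ ≠ tgt ℓ`), `|S| ≤ |V(S)|` for every line set, no parallel pair (`|S| = 2 ⇒ |V(S)| ≥ 3`); then for every family `Υ` of King's external
lines: `|E^{(K+n)}(H) − E^{(K)}(H)| ≤ exp[−δ·treeLength |·| {y_υ}]·L^{−γK}·(A^{2m+nn+|Υ|}·(m!·(m + |Υ| + 1)))` — an INFINITE hypothesis-free class (all trees, all
one-loop graphs without parallel pairs, …). [cite: King1986, Prop. 3.6 (3.56) p.662, p.664, Prop. 3.8 (3.71) p.664, (3.77) p.666] -/
theorem king_prop36_pseudoforest_extLegs_treeDecay (hd1 : 1 ≤ d) (hd3 : d ≤ 3) (hLodd : Odd L) (hL : 2 ≤ L) {a : ℝ} (ha : 0 < a)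
    {m0sq : ℝ} (hm0 : 0 ≤ m0sq) :
    ∃ A γ δ : ℝ, 1 ≤ A ∧ 0 < γ ∧ 0 < δ ∧ ∀ (msq : ℝ), 0 < msq → msq ≤ m0sq → ∀ (jv : KingVolIndex d) (n : ℕ), 1 ≤ n →
      ∀ (nn m : ℕ) (src tgt : Fin m → Fin (nn + 1)), (∀ v, LConn src tgt univ 0 v) →
      (∀ ℓ, src ℓ ≠ tgt ℓ) → (∀ S : Finset (Fin m), S.card ≤ (lineVerts src tgt S).card) →
      (∀ S : Finset (Fin m), S.card = 2 → 3 ≤ (lineVerts src tgt S).card) →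
      ∀ (Υ : Type) [Fintype Υ] [DecidableEq Υ] (vtx : Υ → Fin (nn + 1)) (υ₀ : Υ), vtx υ₀ = 0 →
      ∀ (b : Υ → Tor (kingVol L jv)) (κe : Υ → Option (Fin (d + 1))),
        haveI := kingVol_neZero L jv
        |graphValLS ((((L : ℝ) ^ (jv.K + n))⁻¹) ^ (d + 1)) src tgt (fun _ => kingGLine L (kingVol L jv) a msq (jv.K + n) none) vtx
              (fun υ => kingExtHi L a msq jv n (b υ) (κe υ))
            - graphValLS ((((L : ℝ) ^ jv.K)⁻¹) ^ (d + 1)) src tgt (fun _ => kingGLine L (kingVol L jv) a msq jv.K none) vtx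
              (fun υ => kingExtLo L a msq jv (b υ) (κe υ))|
          ≤ Real.exp (-(δ * treeLength (kingDist L jv) (anchors fun υ => some (basePt (L ^ jv.K) (kingVol L jv) (b υ)))))
            * (L : ℝ) ^ (-(γ * jv.K)) * (A ^ (2 * m + nn + Fintype.card Υ) * ((m.factorial : ℝ) * (m + Fintype.card Υ + 1))) := by
  obtain ⟨A, γ, δ, hA, hγ, hδ, H⟩ := king_prop36_extLegs_treeDecay_collected (d := d) L hLodd hL ha hm0
  refine ⟨A, γ, δ, hA, hγ, hδ, fun msq hm hcap jv n hn nn m src tgt hconn h1 h2 h3 Υ _ _ vtx υ₀ hυ₀ b κe => ?_⟩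
  exact H msq hm hcap jv n hn nn m src tgt hconn (fun _ => none) (posSubgraphsBy_lineExp_pseudoforest hd1 hd3 h1 h2 h3) Υ vtx υ₀ hυ₀ b κe

end Prop36Class

/-! ## §3 The size (3.38)'s shape for the class -/

section SizeClass

/-- ★★ **THEOREM 3.5 (i) (3.38)'s SHAPE FOR EVERY CONNECTED PSEUDOFOREST OF `G`-LINES WITH KING's EXTERNAL LINES** (`1 ≤ d ≤ 3`, no hypothesis on degrees):
part Α-l's `king_graph_size_extLegs_treeDecay_subgraphs` with §1's certificate:
`|E^{(K)}(H)| ≤ exp[−δ·treeLength |·| {y_υ}]·((Q·c368 d δ)·(C₁^m·C₂^{nn}·(Σ_π degConst L (kingDegList …))·Π_{υ≠υ₀} Q))`.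
[cite: King1986, Thm 3.5 (3.38) p.660, p.664, (3.77) p.666] -/
theorem king_graph_size_pseudoforest_extLegs_treeDecay (hd1 : 1 ≤ d) (hd3 : d ≤ 3) (hLodd : Odd L) (hL : 2 ≤ L) {a : ℝ} (ha : 0 < a)
    {m0sq : ℝ} (hm0 : 0 ≤ m0sq) :
    ∃ C₁ C₂ Q δ : ℝ, 0 < C₁ ∧ 0 < C₂ ∧ 0 < Q ∧ 0 < δ ∧ ∀ (msq : ℝ), 0 < msq → msq ≤ m0sq → ∀ (jv : KingVolIndex d)
      (nn m : ℕ) (src tgt : Fin m → Fin (nn + 1)), (∀ v, LConn src tgt univ 0 v) →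
      (∀ ℓ, src ℓ ≠ tgt ℓ) → (∀ S : Finset (Fin m), S.card ≤ (lineVerts src tgt S).card) →
      (∀ S : Finset (Fin m), S.card = 2 → 3 ≤ (lineVerts src tgt S).card) →
      ∀ (Υ : Type) [Fintype Υ] [DecidableEq Υ] (vtx : Υ → Fin (nn + 1)) (υ₀ : Υ), vtx υ₀ = 0 →
      ∀ (b : Υ → Tor (kingVol L jv)) (κe : Υ → Option (Fin (d + 1))),
        haveI := kingVol_neZero L jv
        |graphValLS ((((L : ℝ) ^ jv.K)⁻¹) ^ (d + 1)) src tgt (fun _ => kingGLine L (kingVol L jv) a msq jv.K none) vtx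
            (fun υ => kingExtLo L a msq jv (b υ) (κe υ))|
          ≤ Real.exp (-(δ * treeLength (kingDist L jv) (anchors fun υ => some (basePt (L ^ jv.K) (kingVol L jv) (b υ)))))
            * ((Q * c368 d δ) * (C₁ ^ m * C₂ ^ nn
                * (∑ π : Equiv.Perm (Fin m), degConst L (kingDegList src tgt ((d + 1 : ℕ) : ℝ)
                    (fun ℓ => lineExp (d + 1) ((fun _ : Fin m => (none : Option (Fin (d + 1)))) ℓ)) π))
                * ∏ _υ ∈ univ.erase υ₀, Q)) := by
  obtain ⟨C₁, C₂, Q, δ, hC₁, hC₂, hQ, hδ, H⟩ := king_graph_size_extLegs_treeDecay_subgraphs (d := d) L hLodd hL ha hm0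
  refine ⟨C₁, C₂, Q, δ, hC₁, hC₂, hQ, hδ, fun msq hm hcap jv nn m src tgt hconn h1 h2 h3 Υ _ _ vtx υ₀ hυ₀ b κe => ?_⟩
  exact H msq hm hcap jv nn m src tgt hconn (fun _ => none) (posSubgraphsBy_lineExp_pseudoforest hd1 hd3 h1 h2 h3) Υ vtx υ₀ hυ₀ b κe

end SizeClass

/-! ## §4 (3.56) summed over the field points for the class -/

section SummedClass

/-- ★★ **(3.56) SUMMED OVER THE FIELD POINTS FOR EVERY CONNECTED PSEUDOFOREST OF `G`-LINES** (`1 ≤ d ≤ 3`, no hypothesis on degrees): part Α-n §2's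
`king_prop36_fieldPoints_extLegs_treeDecay` with §1's certificate — legs at fixed unit sites `Υ` (`υ₀` at the vertex `0`, reference leg `υ₁`), `r ≥ 1` legs at
field points summed over the unit lattice against insertions `|A(w)| ≤ a_I(1 + |basePt w − y_{υ₁}|)`:
`|Σ_w (Π_l A(w_l))·(E^{(K+n)} − E^{(K)})(H; {y_υ}, {w_l})| ≤ L^{−γK}·C^{2m+nn+|Υ|+r}·m!·(m + |Υ| + r + 1)·exp[−(δ∕2)·treeLength{y_υ}]·(a_I(1 + 4r∕δ)·e^{δ∕(4r)}K_{d+1}(δ∕(4r)))^r`.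
[cite: King1986, Prop. 3.6 (3.56)–(3.57) p.662, (3.45) p.661, p.664] -/
theorem king_prop36_pseudoforest_fieldPoints_treeDecay (hd1 : 1 ≤ d) (hd3 : d ≤ 3) (hLodd : Odd L) (hL : 2 ≤ L) {a : ℝ} (ha : 0 < a)
    {m0sq : ℝ} (hm0 : 0 ≤ m0sq) :
    ∃ C γ δ : ℝ, 1 ≤ C ∧ 0 < γ ∧ 0 < δ ∧ ∀ (msq : ℝ), 0 < msq → msq ≤ m0sq → ∀ (jv : KingVolIndex d) (n : ℕ), 1 ≤ n →
      ∀ (nn m : ℕ) (src tgt : Fin m → Fin (nn + 1)), (∀ v, LConn src tgt univ 0 v) →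
      (∀ ℓ, src ℓ ≠ tgt ℓ) → (∀ S : Finset (Fin m), S.card ≤ (lineVerts src tgt S).card) →
      (∀ S : Finset (Fin m), S.card = 2 → 3 ≤ (lineVerts src tgt S).card) →
      ∀ (Υ : Type) [Fintype Υ] [DecidableEq Υ] (vtx : Υ → Fin (nn + 1)) (υ₀ : Υ), vtx υ₀ = 0 →
      ∀ (b : Υ → Tor (kingVol L jv)) (κe : Υ → Option (Fin (d + 1))) (υ₁ : Υ) (r : ℕ), 1 ≤ r →
      ∀ (vtxF : Fin r → Fin (nn + 1)) (κF : Fin r → Option (Fin (d + 1))) (aI : ℝ), 0 ≤ aI → ∀ (A : Tor (kingVol L jv) → ℝ),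
        (haveI := kingVol_neZero L jv
         ∀ w, |A w| ≤ aI * (1 + kingDist L jv (basePt (L ^ jv.K) (kingVol L jv) w) (basePt (L ^ jv.K) (kingVol L jv) (b υ₁)))) →
        haveI := kingVol_neZero L jv
        |∑ w : Fin r → Tor (kingVol L jv), (∏ l, A (w l))
            * (graphValLS ((((L : ℝ) ^ (jv.K + n))⁻¹) ^ (d + 1)) src tgt (fun _ => kingGLine L (kingVol L jv) a msq (jv.K + n) none)
                  (Sum.elim vtx vtxF) (fun υ => kingExtHi L a msq jv n (Sum.elim b w υ) (Sum.elim κe κF υ))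
              - graphValLS ((((L : ℝ) ^ jv.K)⁻¹) ^ (d + 1)) src tgt (fun _ => kingGLine L (kingVol L jv) a msq jv.K none)
                  (Sum.elim vtx vtxF) (fun υ => kingExtLo L a msq jv (Sum.elim b w υ) (Sum.elim κe κF υ)))|
          ≤ ((L : ℝ) ^ (-(γ * jv.K)) * (C ^ (2 * m + nn + (Fintype.card Υ + r))
                * ((m.factorial : ℝ) * (m + (Fintype.card Υ + r) + 1))))
            * Real.exp (-(δ / 2 * treeLength (kingDist L jv) (anchors fun υ => some (basePt (L ^ jv.K) (kingVol L jv) (b υ)))))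
            * (aI * (1 + 4 * r / δ) * (Real.exp (δ / (4 * r)) * latticeConst (d + 1) (δ / (4 * r)))) ^ r := by
  obtain ⟨C, γ, δ, hC, hγ, hδ, H⟩ := king_prop36_fieldPoints_extLegs_treeDecay (d := d) L hLodd hL ha hm0
  refine ⟨C, γ, δ, hC, hγ, hδ,
    fun msq hm hcap jv n hn nn m src tgt hconn h1 h2 h3 Υ _ _ vtx υ₀ hυ₀ b κe υ₁ r hr vtxF κF aI haI A hA => ?_⟩
  haveI := kingVol_neZero L jv
  exact H msq hm hcap jv n hn nn m src tgt hconn (fun _ => none) (posSubgraphsBy_lineExp_pseudoforest hd1 hd3 h1 h2 h3)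
    Υ vtx υ₀ hυ₀ b κe υ₁ r hr vtxF κF aI haI A hA

end SummedClass

/-! ## §5 (v1.1) Theorem 3.5 (ii) (3.39)'s shape for the class -/

section Thm35Class

omit L [NeZero L] in
/-- (3.77) verbatim along EVERY ordering for connected pseudoforests of `G`-lines (`1 ≤ d ≤ 3`): §1's certificate read through part Δ-b. [cite: King1986, (3.77) p.666, p.664] -/
theorem posDegrees_kingDegList_pseudoforest {nn m : ℕ} {src tgt : Fin m → Fin (nn + 1)} (hd1 : 1 ≤ d) (hd3 : d ≤ 3)
    (h1 : ∀ ℓ, src ℓ ≠ tgt ℓ) (h2 : ∀ S : Finset (Fin m), S.card ≤ (lineVerts src tgt S).card)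
    (h3 : ∀ S : Finset (Fin m), S.card = 2 → 3 ≤ (lineVerts src tgt S).card) (π : Equiv.Perm (Fin m)) :
    PosDegrees (kingDegList src tgt ((d + 1 : ℕ) : ℝ) (fun ℓ => lineExp (d + 1) ((fun _ : Fin m => (none : Option (Fin (d + 1)))) ℓ)) π) :=
  posDegrees_of_posDegreesBy le_rfl
    (posDegreesBy_kingDegList_of_posSubgraphsBy le_rfl (posSubgraphsBy_lineExp_pseudoforest hd1 hd3 h1 h2 h3) π)

/-- ★★ **THEOREM 3.5 (ii) (3.39)'s SHAPE FOR EVERY CONNECTED PSEUDOFOREST OF `G`-LINES** (`1 ≤ d ≤ 3`, no hypothesis on degrees): part Α-n's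
`king_thm35_fieldPoints_extLegs_treeDecay` with (3.77) discharged by `posDegrees_kingDegList_pseudoforest` — legs at fixed unit sites `Υ` and at `r ≥ 1` field
points summed over the unit lattice against insertions `|A(w)| ≤ a_I(1 + |basePt w − y_{υ₁}|)`:
`|Σ_w (Π_l A(w_l))·E^{(K)}(H; {y_υ}, {w_l})| ≤ (Q·c368 d δ)·(C₁^m·C₂^{nn}·(Σ_π degConst)·Q^{|Υ|+r−1})·exp[−(δ∕2)·treeLength{y_υ}]·(a_I(1 + 4r∕δ)·e^{δ∕(4r)}K_{d+1}(δ∕(4r)))^r`.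
[cite: King1986, Thm 3.5 (3.39) p.660, (3.55)–(3.57) p.662, (3.45) p.661, p.664, (3.77) p.666] -/
theorem king_thm35_pseudoforest_fieldPoints_treeDecay (hd1 : 1 ≤ d) (hd3 : d ≤ 3) (hLodd : Odd L) (hL : 2 ≤ L) {a : ℝ} (ha : 0 < a)
    {m0sq : ℝ} (hm0 : 0 ≤ m0sq) :
    ∃ C₁ C₂ Q δ : ℝ, 0 < C₁ ∧ 0 < C₂ ∧ 0 < Q ∧ 0 < δ ∧ ∀ (msq : ℝ), 0 < msq → msq ≤ m0sq → ∀ (jv : KingVolIndex d)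
      (nn m : ℕ) (src tgt : Fin m → Fin (nn + 1)), (∀ v, LConn src tgt univ 0 v) →
      (∀ ℓ, src ℓ ≠ tgt ℓ) → (∀ S : Finset (Fin m), S.card ≤ (lineVerts src tgt S).card) →
      (∀ S : Finset (Fin m), S.card = 2 → 3 ≤ (lineVerts src tgt S).card) →
      ∀ (Υ : Type) [Fintype Υ] [DecidableEq Υ] (vtx : Υ → Fin (nn + 1)) (υ₀ : Υ), vtx υ₀ = 0 →
      ∀ (b : Υ → Tor (kingVol L jv)) (κe : Υ → Option (Fin (d + 1))) (υ₁ : Υ) (r : ℕ), 1 ≤ r →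
      ∀ (vtxF : Fin r → Fin (nn + 1)) (κF : Fin r → Option (Fin (d + 1))) (aI : ℝ), 0 ≤ aI → ∀ (A : Tor (kingVol L jv) → ℝ),
        (haveI := kingVol_neZero L jv
         ∀ w, |A w| ≤ aI * (1 + kingDist L jv (basePt (L ^ jv.K) (kingVol L jv) w) (basePt (L ^ jv.K) (kingVol L jv) (b υ₁)))) →
        haveI := kingVol_neZero L jv
        |∑ w : Fin r → Tor (kingVol L jv), (∏ l, A (w l))
            * graphValLS ((((L : ℝ) ^ jv.K)⁻¹) ^ (d + 1)) src tgt (fun _ => kingGLine L (kingVol L jv) a msq jv.K none) (Sum.elim vtx vtxF)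
                (fun υ => kingExtLo L a msq jv (Sum.elim b w υ) (Sum.elim κe κF υ))|
          ≤ (Q * c368 d δ) * (C₁ ^ m * C₂ ^ nn
                * (∑ π : Equiv.Perm (Fin m), degConst L (kingDegList src tgt ((d + 1 : ℕ) : ℝ)
                    (fun ℓ => lineExp (d + 1) ((fun _ : Fin m => (none : Option (Fin (d + 1)))) ℓ)) π))
                * Q ^ (Fintype.card Υ + r - 1))
            * Real.exp (-(δ / 2 * treeLength (kingDist L jv) (anchors fun υ => some (basePt (L ^ jv.K) (kingVol L jv) (b υ)))))
            * (aI * (1 + 4 * r / δ) * (Real.exp (δ / (4 * r)) * latticeConst (d + 1) (δ / (4 * r)))) ^ r := by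
  obtain ⟨C₁, C₂, Q, δ, hC₁, hC₂, hQ, hδ, H⟩ := king_thm35_fieldPoints_extLegs_treeDecay (d := d) L hLodd hL ha hm0
  refine ⟨C₁, C₂, Q, δ, hC₁, hC₂, hQ, hδ,
    fun msq hm hcap jv nn m src tgt hconn h1 h2 h3 Υ _ _ vtx υ₀ hυ₀ b κe υ₁ r hr vtxF κF aI haI A hA => ?_⟩
  haveI := kingVol_neZero L jv
  exact H msq hm hcap jv nn m src tgt hconn (fun _ => none) (posDegrees_kingDegList_pseudoforest hd1 hd3 h1 h2 h3)
    Υ vtx υ₀ hυ₀ b κe υ₁ r hr vtxF κF aI haI A hA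

end Thm35Class

end Summit.QuantumFields.YangMills.BalabanUVNodes.N15KingModelRung.Curved

end
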